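import Summits.AtomisticToContinuum.BoseEinsteinCondensation.Theorems.BECThomsonPrincipleFibreConductanceStubLineFubini
import HarnessLib

/-!
# Route `BECThomsonPrinciple`, crux `FibreConductance` (stmt-AtomisticToContinuum-9480),
# line `parseval-shell-bootstrap` (r4) — stub `stub_lineMoments`: THE BATH MOMENT OF THE
# FLATTENING FLOW FROM `ConditionalDensityMoments`

`stub_lineMoments : Goal.stub_lineMoments` (`= LineFubini → ConditionalDensityMoments →
LineMomentBound` of `Theorems/BECThomsonPrincipleFibreConductanceFlatteningDefs.lean`): for bounded
repulsive finite-range `v`, exact zero-free minimisers at low density satisfy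
`∫_{cellN} W(X̂)·(∫_cell (Σᵢ⟨g⟩ᵢ⁶)·g⁻³ (X[0↦y]) dy) dX ≤ K L⁶` with `K = 3√(C₁₂C₆)`, `C_p` the
constants of `ConditionalDensityMoments` at the orders `p = 12, 6` (`g = L³ψ²`, `⟨g⟩ᵢ` its iterated
line averages `gAvg1/2/3`).

* `lintegral_ofReal_weight_mul_le` — Cauchy–Schwarz with a weight `w ≥ 0`:
  `∫ w·a·b ≤ (∫ w a²)^{1/2} (∫ w b²)^{1/2}` (`ENNReal.lintegral_mul_le_Lp_mul_Lq` for
  `√w·a`, `√w·b`);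
* `pow_lineAvg_le` — Jensen for line averages, `⟨F⟩_l^n ≤ ⟨F^n⟩_l` for continuous `F ≥ 0`
  (`ConvexOn.map_set_average_le`, `convexOn_pow`);
* `lintegral_fibreW_mul_lineAvg` — the AVERAGING LEMMA `∫_{cellN} W·⟨F⟩_l = ∫_{cellN} W·F`
  (`W` is fibre-constant, `lintegral_cellN_eq_fibre_average`, and `LineFubini` on each fibre cell),
  whence `∫ W⟨F⟩_l^n ≤ ∫ W F^n` (`lintegral_fibreW_mul_pow_lineAvg_le`) and, iterating,
  `∫ W⟨g⟩ᵢ¹² ≤ ∫ W g¹²` for `i = 1, 2, 3`;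
* `lintegral_fibreW_mul_lintegral_cell_eq` — the inner fibre integral spreads to
  `L³ ∫_{cellN} W·(Σᵢ⟨g⟩ᵢ⁶)g⁻³` (`lintegral_cellN_lintegral_update`, `fibreW_update`);
* `lintegral_fibreW_mul_lineMomentIntegrand_le` — split the three terms;
  `lintegral_term_le` — Cauchy–Schwarz in the bath `∫ W a⁶ g⁻³ ≤ (∫ W a¹²)^{1/2}(∫ W g⁻⁶)^{1/2}`;
* `lineMomentBound_of` — assembly with `ConditionalDensityMoments` at `p = 12` (`∫ W g¹² ≤ C₁₂L³`)
  and `p = 6` (`∫ W g⁻⁶ ≤ C₆L³`): `L³ · 3 · √(C₁₂L³) √(C₆L³) = 3√(C₁₂C₆) L⁶`.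

All [folklore] (Fubini–Tonelli, Hölder and Jensen; G. B. Folland, *Real Analysis* (1999),
Thm. 2.37, Thm. 6.2, §3.5 ex. 42 (Jensen)).
-/

noncomputable section

namespace Summit.AtomisticToContinuum.BoseEinsteinCondensation.Cruxes.FibreConductance.ParsevalShellBootstrap

open MeasureTheory
open scoped ENNReal
open Literature.MathematicalPhysics.QuantumManyBody.BoseGas
open Summit.AtomisticToContinuum.BoseEinsteinCondensation.Cruxes.FibreConductance.TaggedPathHarnack

variable {m : ℕ} {L : ℝ}

/-! ### Cauchy–Schwarz with a weight -/

/-- **Cauchy–Schwarz with a weight.** For measurable `w, a, b ≥ 0`,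
`∫ w·(a·b) ≤ (∫ w·a²)^{1/2} · (∫ w·b²)^{1/2}` (Hölder `(2, 2)` for `√w·a` and `√w·b`; Folland,
*Real Analysis*, Thm. 6.2). [folklore] -/
theorem lintegral_ofReal_weight_mul_le {α : Type*} [MeasurableSpace α] (μ : Measure α)
    {w a b : α → ℝ} (hw : Measurable w) (ha : Measurable a) (hb : Measurable b)
    (hw0 : ∀ x, 0 ≤ w x) (ha0 : ∀ x, 0 ≤ a x) (hb0 : ∀ x, 0 ≤ b x) :
    ∫⁻ x, ENNReal.ofReal (w x * (a x * b x)) ∂μ ≤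
      (∫⁻ x, ENNReal.ofReal (w x * a x ^ 2) ∂μ) ^ (1 / 2 : ℝ) *
        (∫⁻ x, ENNReal.ofReal (w x * b x ^ 2) ∂μ) ^ (1 / 2 : ℝ) := by
  set f : α → ℝ≥0∞ := fun x => ENNReal.ofReal (Real.sqrt (w x) * a x) with hf
  set g : α → ℝ≥0∞ := fun x => ENNReal.ofReal (Real.sqrt (w x) * b x) with hg
  have hfg : ∀ x, ENNReal.ofReal (w x * (a x * b x)) = (f * g) x := fun x => by
    simp only [Pi.mul_apply, hf, hg]
    have h : Real.sqrt (w x) * a x * (Real.sqrt (w x) * b x) = w x * (a x * b x) := by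
      rw [mul_mul_mul_comm, Real.mul_self_sqrt (hw0 x)]
    rw [← ENNReal.ofReal_mul (mul_nonneg (Real.sqrt_nonneg _) (ha0 x)), h]
  have hf2 : ∀ x, f x ^ (2 : ℝ) = ENNReal.ofReal (w x * a x ^ 2) := fun x => by
    simp only [hf]
    rw [ENNReal.rpow_two, ← ENNReal.ofReal_pow (mul_nonneg (Real.sqrt_nonneg _) (ha0 x)), mul_pow,
      Real.sq_sqrt (hw0 x)]
  have hg2 : ∀ x, g x ^ (2 : ℝ) = ENNReal.ofReal (w x * b x ^ 2) := fun x => by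
    simp only [hg]
    rw [ENNReal.rpow_two, ← ENNReal.ofReal_pow (mul_nonneg (Real.sqrt_nonneg _) (hb0 x)), mul_pow,
      Real.sq_sqrt (hw0 x)]
  have hfm : AEMeasurable f μ := (hw.sqrt.fun_mul ha).ennreal_ofReal.aemeasurable
  have hgm : AEMeasurable g μ := (hw.sqrt.fun_mul hb).ennreal_ofReal.aemeasurable
  have hpq : (2 : ℝ).HolderConjugate 2 := Real.holderConjugate_iff.2 ⟨by norm_num, by norm_num⟩
  calc ∫⁻ x, ENNReal.ofReal (w x * (a x * b x)) ∂μ = ∫⁻ x, (f * g) x ∂μ := lintegral_congr hfg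
    _ ≤ (∫⁻ x, f x ^ (2 : ℝ) ∂μ) ^ (1 / (2 : ℝ)) * (∫⁻ x, g x ^ (2 : ℝ) ∂μ) ^ (1 / (2 : ℝ)) :=
        ENNReal.lintegral_mul_le_Lp_mul_Lq μ hpq hfm hgm
    _ = _ := by rw [lintegral_congr hf2, lintegral_congr hg2]

/-! ### Jensen for line averages -/

/-- **Jensen for line averages.** For continuous `F ≥ 0`, `L > 0` and every `n`,
`⟨F⟩_l(Y)^n ≤ ⟨F^n⟩_l(Y)`: the line average is the average of `t ↦ F (linePt l Y t)` over
`(0, L]`, and `x ↦ x^n` is convex on `[0, ∞)` (`ConvexOn.map_set_average_le`). [folklore] -/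
theorem pow_lineAvg_le (hL : 0 < L) (l : Fin 3) {F : Config (m + 1) → ℝ} (hF : Continuous F)
    (hF0 : ∀ Y, 0 ≤ F Y) (n : ℕ) (Y : Config (m + 1)) :
    lineAvg L l F Y ^ n ≤ lineAvg L l (fun Z => F Z ^ n) Y := by
  have hφc : Continuous fun t : ℝ => F (linePt l Y t) := hF.comp (continuous_linePt l Y)
  have hvol : volume (Set.Ioc (0 : ℝ) L) = ENNReal.ofReal L := by rw [Real.volume_Ioc, sub_zero]
  have hne : volume (Set.Ioc (0 : ℝ) L) ≠ 0 := by
    rw [hvol]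
    exact (ENNReal.ofReal_pos.2 hL).ne'
  have htop : volume (Set.Ioc (0 : ℝ) L) ≠ ⊤ := by
    rw [hvol]
    exact ENNReal.ofReal_ne_top
  have hJ := ConvexOn.map_set_average_le (μ := volume) (t := Set.Ioc (0 : ℝ) L)
    (f := fun t : ℝ => F (linePt l Y t)) (g := fun x : ℝ => x ^ n) (s := Set.Ici 0) (convexOn_pow n)
    (continuous_pow n).continuousOn isClosed_Ici hne htop
    (ae_of_all _ fun t => Set.mem_Ici.2 (hF0 _)) hφc.integrableOn_Ioc (hφc.pow n).integrableOn_Ioc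
  have hreal : volume.real (Set.Ioc (0 : ℝ) L) = L := by
    rw [measureReal_def, hvol, ENNReal.toReal_ofReal hL.le]
  rw [setAverage_eq, setAverage_eq, hreal, smul_eq_mul, smul_eq_mul] at hJ
  simp only [lineAvg, intervalIntegral.integral_of_le hL.le]
  exact hJ

/-! ### The averaging lemma: `∫ W·⟨F⟩_l = ∫ W·F` in the bath -/

/-- **Averaging lemma.** For continuous `F ≥ 0`, any fibre axis `l` and `L > 0`,
`∫_{cellN} W·⟨F⟩_l dX = ∫_{cellN} W·F dX`: both sides are `L⁻³ ∫_{cellN} ∫_cell (·)(X[0↦y]) dy dX`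
(`lintegral_cellN_eq_fibre_average`), `W(X[0↦y]) = W(X)` comes out of the inner integral
(`fibreW_update`), and the inner integrals agree by `LineFubini`. (Folland, *Real Analysis*,
Thm. 2.37.) [folklore] -/
theorem lintegral_fibreW_mul_lineAvg (hlf : LineFubini) (hL : 0 < L) (l : Fin 3)
    (Φ : PeriodicTrialState (m + 1) L) {F : Config (m + 1) → ℝ} (hF : Continuous F)
    (hF0 : ∀ Y, 0 ≤ F Y) :
    ∫⁻ X in cellN (m + 1) L, ENNReal.ofReal (fibreW Φ X * lineAvg L l F X) =
      ∫⁻ X in cellN (m + 1) L, ENNReal.ofReal (fibreW Φ X * F X) := by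
  have h1 : Measurable fun Y => ENNReal.ofReal (fibreW Φ Y * lineAvg L l F Y) :=
    ((measurable_fibreW Φ).fun_mul
      (continuous_lineAvg_of_continuous L l hF).measurable).ennreal_ofReal
  have h2 : Measurable fun Y => ENNReal.ofReal (fibreW Φ Y * F Y) :=
    ((measurable_fibreW Φ).fun_mul hF.measurable).ennreal_ofReal
  rw [lintegral_cellN_eq_fibre_average hL h1, lintegral_cellN_eq_fibre_average hL h2]
  congr 1
  refine lintegral_congr fun X => ?_
  simp only [fibreW_update, ENNReal.ofReal_mul (fibreW_nonneg Φ X)]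
  rw [lintegral_const_mul' _ _ ENNReal.ofReal_ne_top,
    lintegral_const_mul' _ _ ENNReal.ofReal_ne_top, hlf m L hL l F hF hF0 X]

/-- **One Jensen–Fubini step in the bath**: `∫_{cellN} W·⟨F⟩_l^n ≤ ∫_{cellN} W·F^n` for continuous
`F ≥ 0` (`pow_lineAvg_le` pointwise, then the averaging lemma for `F^n`). [folklore] -/
theorem lintegral_fibreW_mul_pow_lineAvg_le (hlf : LineFubini) (hL : 0 < L) (l : Fin 3)
    (Φ : PeriodicTrialState (m + 1) L) {F : Config (m + 1) → ℝ} (hF : Continuous F)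
    (hF0 : ∀ Y, 0 ≤ F Y) (n : ℕ) :
    ∫⁻ X in cellN (m + 1) L, ENNReal.ofReal (fibreW Φ X * lineAvg L l F X ^ n) ≤
      ∫⁻ X in cellN (m + 1) L, ENNReal.ofReal (fibreW Φ X * F X ^ n) :=
  calc ∫⁻ X in cellN (m + 1) L, ENNReal.ofReal (fibreW Φ X * lineAvg L l F X ^ n)
      ≤ ∫⁻ X in cellN (m + 1) L, ENNReal.ofReal (fibreW Φ X * lineAvg L l (fun Z => F Z ^ n) X) :=
        lintegral_mono fun X => ENNReal.ofReal_le_ofReal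
          (mul_le_mul_of_nonneg_left (pow_lineAvg_le hL l hF hF0 n X) (fibreW_nonneg Φ X))
    _ = ∫⁻ X in cellN (m + 1) L, ENNReal.ofReal (fibreW Φ X * F X ^ n) :=
        lintegral_fibreW_mul_lineAvg hlf hL l Φ (hF.fun_pow n) fun Y => pow_nonneg (hF0 Y) n

/-! ### The objects: positivity, continuity, measurability -/

/-- `g = L³ψ² > 0` for a zero-free state (`L > 0`). [folklore] -/
theorem gDens_pos (hL : 0 < L) (Φ : PeriodicTrialState (m + 1) L) (hΦ : ∀ X, Φ.ψ X ≠ 0)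
    (X : Config (m + 1)) : 0 < gDens L Φ X :=
  mul_pos (pow_pos hL 3) (pow_pos (fibrePsi_pos hL Φ hΦ X) 2)

/-- `g⁻¹` is continuous for a zero-free state (`L > 0`). [folklore] -/
theorem continuous_gDens_inv (hL : 0 < L) (Φ : PeriodicTrialState (m + 1) L) (hΦ : ∀ X, Φ.ψ X ≠ 0) :
    Continuous fun X => (gDens L Φ X)⁻¹ :=
  (contDiff_gDens hL Φ hΦ).continuous.fun_inv₀ fun X => (gDens_pos hL Φ hΦ X).ne'

/-- The line-moment integrand is continuous (zero-free state, `L > 0`). [folklore] -/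
theorem continuous_lineMomentIntegrand (hL : 0 < L) (Φ : PeriodicTrialState (m + 1) L)
    (hΦ : ∀ X, Φ.ψ X ≠ 0) : Continuous (lineMomentIntegrand L Φ) := by
  have h1 := (contDiff_gAvg1 hL Φ hΦ).continuous
  have h2 := (contDiff_gAvg2 hL Φ hΦ).continuous
  have h3 := (contDiff_gAvg3 hL Φ hΦ).continuous
  have hi := continuous_gDens_inv hL Φ hΦ
  show Continuous fun X =>
    (gAvg1 L Φ X ^ 6 + gAvg2 L Φ X ^ 6 + gAvg3 L Φ X ^ 6) * ((gDens L Φ X)⁻¹) ^ 3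
  exact (((h1.fun_pow 6).fun_add (h2.fun_pow 6)).fun_add (h3.fun_pow 6)).fun_mul (hi.fun_pow 3)

/-- `W·(Σᵢ⟨g⟩ᵢ⁶)g⁻³` is measurable, as an `ℝ≥0∞`-valued function. [folklore] -/
theorem measurable_fibreW_mul_lineMomentIntegrand (hL : 0 < L) (Φ : PeriodicTrialState (m + 1) L)
    (hΦ : ∀ X, Φ.ψ X ≠ 0) :
    Measurable fun X => ENNReal.ofReal (fibreW Φ X * lineMomentIntegrand L Φ X) :=
  ((measurable_fibreW Φ).fun_mul (continuous_lineMomentIntegrand hL Φ hΦ).measurable).ennreal_ofReal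

/-- `W·a⁶·(g⁻¹)³` is measurable for continuous `a`. [folklore] -/
theorem measurable_fibreW_mul_term (hL : 0 < L) (Φ : PeriodicTrialState (m + 1) L)
    (hΦ : ∀ X, Φ.ψ X ≠ 0) {a : Config (m + 1) → ℝ} (ha : Continuous a) :
    Measurable fun X => ENNReal.ofReal (fibreW Φ X * (a X ^ 6 * ((gDens L Φ X)⁻¹) ^ 3)) :=
  ((continuous_fibreW Φ).fun_mul ((ha.fun_pow 6).fun_mul
    ((continuous_gDens_inv hL Φ hΦ).fun_pow 3))).measurable.ennreal_ofReal

/-! ### Step 1: the inner fibre integral spreads over the bath -/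

/-- **Spreading the fibre integral.** `W` is constant along the fibre (`fibreW_update`), so
`∫_{cellN} W(X)·(∫_cell M(X[0↦y]) dy) dX = ∫_{cellN}∫_cell (W·M)(X[0↦y]) dy dX = L³ ∫_{cellN} W·M`
(`lintegral_cellN_lintegral_update`), `M = lineMomentIntegrand`. (Folland, *Real Analysis*,
Thm. 2.37.) [folklore] -/
theorem lintegral_fibreW_mul_lintegral_cell_eq (hL : 0 < L) (Φ : PeriodicTrialState (m + 1) L)
    (hΦ : ∀ X, Φ.ψ X ≠ 0) :
    ∫⁻ X in cellN (m + 1) L, ENNReal.ofReal (fibreW Φ X) *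
        ∫⁻ y in cell L, ENNReal.ofReal (lineMomentIntegrand L Φ (Function.update X 0 y)) =
      ENNReal.ofReal L ^ 3 *
        ∫⁻ X in cellN (m + 1) L, ENNReal.ofReal (fibreW Φ X * lineMomentIntegrand L Φ X) := by
  rw [← lintegral_cellN_lintegral_update 0 (measurable_fibreW_mul_lineMomentIntegrand hL Φ hΦ)]
  refine lintegral_congr fun X => ?_
  rw [← lintegral_const_mul' _ _ ENNReal.ofReal_ne_top]
  refine lintegral_congr fun y => ?_
  rw [ENNReal.ofReal_mul (fibreW_nonneg Φ _), fibreW_update]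

/-! ### Step 2: split the three terms -/

/-- **Splitting.** `∫ W·(a₁⁶ + a₂⁶ + a₃⁶)(g⁻¹)³ ≤ Σᵢ ∫ W·aᵢ⁶(g⁻¹)³` (`ofReal` is subadditive,
`lintegral_add_left`). [folklore] -/
theorem lintegral_fibreW_mul_lineMomentIntegrand_le (hL : 0 < L) (Φ : PeriodicTrialState (m + 1) L)
    (hΦ : ∀ X, Φ.ψ X ≠ 0) :
    ∫⁻ X in cellN (m + 1) L, ENNReal.ofReal (fibreW Φ X * lineMomentIntegrand L Φ X) ≤
      (∫⁻ X in cellN (m + 1) L,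
          ENNReal.ofReal (fibreW Φ X * (gAvg1 L Φ X ^ 6 * ((gDens L Φ X)⁻¹) ^ 3))) +
        (∫⁻ X in cellN (m + 1) L,
            ENNReal.ofReal (fibreW Φ X * (gAvg2 L Φ X ^ 6 * ((gDens L Φ X)⁻¹) ^ 3))) +
          ∫⁻ X in cellN (m + 1) L,
            ENNReal.ofReal (fibreW Φ X * (gAvg3 L Φ X ^ 6 * ((gDens L Φ X)⁻¹) ^ 3)) := by
  have h1 := measurable_fibreW_mul_term hL Φ hΦ (contDiff_gAvg1 hL Φ hΦ).continuous
  have h2 := measurable_fibreW_mul_term hL Φ hΦ (contDiff_gAvg2 hL Φ hΦ).continuous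
  have h12 : Measurable fun X =>
      ENNReal.ofReal (fibreW Φ X * (gAvg1 L Φ X ^ 6 * ((gDens L Φ X)⁻¹) ^ 3)) +
        ENNReal.ofReal (fibreW Φ X * (gAvg2 L Φ X ^ 6 * ((gDens L Φ X)⁻¹) ^ 3)) := h1.fun_add h2
  calc ∫⁻ X in cellN (m + 1) L, ENNReal.ofReal (fibreW Φ X * lineMomentIntegrand L Φ X)
      ≤ ∫⁻ X in cellN (m + 1) L,
          (ENNReal.ofReal (fibreW Φ X * (gAvg1 L Φ X ^ 6 * ((gDens L Φ X)⁻¹) ^ 3)) +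
            ENNReal.ofReal (fibreW Φ X * (gAvg2 L Φ X ^ 6 * ((gDens L Φ X)⁻¹) ^ 3)) +
              ENNReal.ofReal (fibreW Φ X * (gAvg3 L Φ X ^ 6 * ((gDens L Φ X)⁻¹) ^ 3))) := by
        refine lintegral_mono fun X => ?_
        have e : fibreW Φ X * lineMomentIntegrand L Φ X =
            fibreW Φ X * (gAvg1 L Φ X ^ 6 * ((gDens L Φ X)⁻¹) ^ 3) +
              fibreW Φ X * (gAvg2 L Φ X ^ 6 * ((gDens L Φ X)⁻¹) ^ 3) +
                fibreW Φ X * (gAvg3 L Φ X ^ 6 * ((gDens L Φ X)⁻¹) ^ 3) := by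
          simp only [lineMomentIntegrand]
          ring
        rw [e]
        exact ENNReal.ofReal_add_le.trans (add_le_add ENNReal.ofReal_add_le le_rfl)
    _ = _ := by rw [lintegral_add_left h12, lintegral_add_left h1]

/-! ### Step 3: Cauchy–Schwarz in the bath, term by term -/

/-- **Cauchy–Schwarz in the bath.** For continuous `a ≥ 0`,
`∫_{cellN} W·a⁶(g⁻¹)³ ≤ (∫_{cellN} W·a¹²)^{1/2} · (∫_{cellN} W·(g⁻¹)⁶)^{1/2}`.
(Folland, *Real Analysis*, Thm. 6.2.) [folklore] -/
theorem lintegral_term_le (hL : 0 < L) (Φ : PeriodicTrialState (m + 1) L) (hΦ : ∀ X, Φ.ψ X ≠ 0)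
    {a : Config (m + 1) → ℝ} (ha : Continuous a) (ha0 : ∀ Y, 0 ≤ a Y) :
    ∫⁻ X in cellN (m + 1) L, ENNReal.ofReal (fibreW Φ X * (a X ^ 6 * ((gDens L Φ X)⁻¹) ^ 3)) ≤
      (∫⁻ X in cellN (m + 1) L, ENNReal.ofReal (fibreW Φ X * a X ^ 12)) ^ (1 / 2 : ℝ) *
        (∫⁻ X in cellN (m + 1) L,
          ENNReal.ofReal (fibreW Φ X * ((gDens L Φ X)⁻¹) ^ 6)) ^ (1 / 2 : ℝ) := by
  have h := lintegral_ofReal_weight_mul_le (volume.restrict (cellN (m + 1) L)) (measurable_fibreW Φ)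
    (ha.measurable.pow_const 6) ((continuous_gDens_inv hL Φ hΦ).measurable.pow_const 3)
    (fibreW_nonneg Φ) (fun Y => pow_nonneg (ha0 Y) 6)
    (fun Y => pow_nonneg (inv_nonneg.2 (gDens_nonneg hL.le Φ Y)) 3)
  have e1 : ∀ Y, (a Y ^ 6) ^ 2 = a Y ^ 12 := fun Y => by rw [← pow_mul]
  have e2 : ∀ Y : Config (m + 1), (((gDens L Φ Y)⁻¹) ^ 3) ^ 2 = ((gDens L Φ Y)⁻¹) ^ 6 := fun Y => by
    rw [← pow_mul]
  simp only [e1, e2] at h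
  exact h

/-! ### Assembly -/

/-- **`LineFubini → ConditionalDensityMoments → LineMomentBound`.** With `(ρ₁₂, C₁₂, N₁₂)` and
`(ρ₆, C₆, N₆)` the data of `ConditionalDensityMoments` at `p = 12` and `p = 6`, take
`ρ₀ = min ρ₁₂ ρ₆`, `N₀ = max N₁₂ N₆`, `K = 3√(C₁₂C₆)`. For a datum: spread the fibre integral
(`× L³`), split the three terms, Cauchy–Schwarz each, bound `∫ W⟨g⟩ᵢ¹² ≤ ∫ W g¹² ≤ ∫ W(g¹² + g⁻¹²)
≤ C₁₂L³` (Jensen–Fubini steps, `i` of them) and `∫ W g⁻⁶ ≤ ∫ W(g⁶ + g⁻⁶) ≤ C₆L³`, and collect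
`L³ · 3 · √(C₁₂L³)·√(C₆L³) = 3√(C₁₂C₆) L⁶`. [folklore] -/
theorem lineMomentBound_of (hlf : LineFubini) (hcdm : ConditionalDensityMoments) :
    LineMomentBound := by
  intro v hv hB
  obtain ⟨ρ₁, C₁, hρ₁, hC₁, N₁, h₁⟩ := hcdm v hv hB 12
  obtain ⟨ρ₂, C₂, hρ₂, hC₂, N₂, h₂⟩ := hcdm v hv hB 6
  refine ⟨min ρ₁ ρ₂, 3 * Real.sqrt (C₁ * C₂), lt_min hρ₁ hρ₂, by positivity, max N₁ N₂,
    fun m hm L hL hρ Φ hE hz => ?_⟩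
  have hL3 : 0 < L ^ 3 := pow_pos hL 3
  have hρ₁' : ((m + 1 : ℕ) : ℝ) ≤ ρ₁ * L ^ 3 :=
    hρ.trans (mul_le_mul_of_nonneg_right (min_le_left _ _) hL3.le)
  have hρ₂' : ((m + 1 : ℕ) : ℝ) ≤ ρ₂ * L ^ 3 :=
    hρ.trans (mul_le_mul_of_nonneg_right (min_le_right _ _) hL3.le)
  have hg := (contDiff_gDens hL Φ hz).continuous
  have hg0 := gDens_nonneg hL.le Φ
  -- the two moments of `ConditionalDensityMoments`
  have hP : ∫⁻ X in cellN (m + 1) L, ENNReal.ofReal (fibreW Φ X * gDens L Φ X ^ 12) ≤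
      ENNReal.ofReal (C₁ * L ^ 3) := by
    refine le_trans (lintegral_mono fun X => ENNReal.ofReal_le_ofReal ?_)
      (h₁ m (le_trans (le_max_left _ _) hm) L hL hρ₁' Φ hE hz)
    exact mul_le_mul_of_nonneg_left
      (le_add_of_nonneg_right (pow_nonneg (inv_nonneg.2 (hg0 X)) 12)) (fibreW_nonneg Φ X)
  have hQ : ∫⁻ X in cellN (m + 1) L, ENNReal.ofReal (fibreW Φ X * ((gDens L Φ X)⁻¹) ^ 6) ≤
      ENNReal.ofReal (C₂ * L ^ 3) := by
    refine le_trans (lintegral_mono fun X => ENNReal.ofReal_le_ofReal ?_)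
      (h₂ m (le_trans (le_max_right _ _) hm) L hL hρ₂' Φ hE hz)
    exact mul_le_mul_of_nonneg_left (le_add_of_nonneg_left (pow_nonneg (hg0 X) 6))
      (fibreW_nonneg Φ X)
  -- Jensen–Fubini: `∫ W⟨g⟩ᵢ¹² ≤ ∫ W g¹²`
  have ha1 := (contDiff_gAvg1 hL Φ hz).continuous
  have ha2 := (contDiff_gAvg2 hL Φ hz).continuous
  have ha3 := (contDiff_gAvg3 hL Φ hz).continuous
  have ha10 := gAvg1_nonneg hL.le Φ
  have ha20 := gAvg2_nonneg hL.le Φ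
  have ha30 := gAvg3_nonneg hL.le Φ
  have hA1 : ∫⁻ X in cellN (m + 1) L, ENNReal.ofReal (fibreW Φ X * gAvg1 L Φ X ^ 12) ≤
      ∫⁻ X in cellN (m + 1) L, ENNReal.ofReal (fibreW Φ X * gDens L Φ X ^ 12) :=
    lintegral_fibreW_mul_pow_lineAvg_le hlf hL 2 Φ hg hg0 12
  have hA2 : ∫⁻ X in cellN (m + 1) L, ENNReal.ofReal (fibreW Φ X * gAvg2 L Φ X ^ 12) ≤
      ∫⁻ X in cellN (m + 1) L, ENNReal.ofReal (fibreW Φ X * gDens L Φ X ^ 12) :=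
    (lintegral_fibreW_mul_pow_lineAvg_le hlf hL 1 Φ ha1 ha10 12).trans hA1
  have hA3 : ∫⁻ X in cellN (m + 1) L, ENNReal.ofReal (fibreW Φ X * gAvg3 L Φ X ^ 12) ≤
      ∫⁻ X in cellN (m + 1) L, ENNReal.ofReal (fibreW Φ X * gDens L Φ X ^ 12) :=
    (lintegral_fibreW_mul_pow_lineAvg_le hlf hL 0 Φ ha2 ha20 12).trans hA2
  -- Cauchy–Schwarz, term by term
  set R : ℝ≥0∞ :=
    ENNReal.ofReal (C₁ * L ^ 3) ^ (1 / 2 : ℝ) * ENNReal.ofReal (C₂ * L ^ 3) ^ (1 / 2 : ℝ) with hRdef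
  have hT : ∀ {a : Config (m + 1) → ℝ}, Continuous a → (∀ Y, 0 ≤ a Y) →
      ∫⁻ X in cellN (m + 1) L, ENNReal.ofReal (fibreW Φ X * a X ^ 12) ≤
        ∫⁻ X in cellN (m + 1) L, ENNReal.ofReal (fibreW Φ X * gDens L Φ X ^ 12) →
      ∫⁻ X in cellN (m + 1) L,
        ENNReal.ofReal (fibreW Φ X * (a X ^ 6 * ((gDens L Φ X)⁻¹) ^ 3)) ≤ R :=
    fun ha ha0 hA => (lintegral_term_le hL Φ hz ha ha0).trans
      (mul_le_mul' (ENNReal.rpow_le_rpow (hA.trans hP) (by norm_num))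
        (ENNReal.rpow_le_rpow hQ (by norm_num)))
  have hR : R = ENNReal.ofReal (Real.sqrt (C₁ * C₂) * L ^ 3) := by
    rw [hRdef, ← ENNReal.mul_rpow_of_nonneg _ _ (by norm_num : (0 : ℝ) ≤ 1 / 2),
      ← ENNReal.ofReal_mul (by positivity : (0 : ℝ) ≤ C₁ * L ^ 3),
      ENNReal.ofReal_rpow_of_nonneg (by positivity) (by norm_num), ← Real.sqrt_eq_rpow]
    congr 1
    rw [show C₁ * L ^ 3 * (C₂ * L ^ 3) = C₁ * C₂ * (L ^ 3 * L ^ 3) by ring,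
      Real.sqrt_mul (by positivity : (0 : ℝ) ≤ C₁ * C₂), Real.sqrt_mul_self hL3.le]
  have hx : 0 ≤ Real.sqrt (C₁ * C₂) * L ^ 3 := by positivity
  -- assembly
  rw [lintegral_fibreW_mul_lintegral_cell_eq hL Φ hz]
  calc ENNReal.ofReal L ^ 3 *
        ∫⁻ X in cellN (m + 1) L, ENNReal.ofReal (fibreW Φ X * lineMomentIntegrand L Φ X)
      ≤ ENNReal.ofReal L ^ 3 * (R + R + R) :=
        mul_le_mul_right ((lintegral_fibreW_mul_lineMomentIntegrand_le hL Φ hz).trans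
          (add_le_add (add_le_add (hT ha1 ha10 hA1) (hT ha2 ha20 hA2)) (hT ha3 ha30 hA3))) _
    _ = ENNReal.ofReal (3 * Real.sqrt (C₁ * C₂) * L ^ 6) := by
        rw [hR, ← ENNReal.ofReal_add hx hx, ← ENNReal.ofReal_add (add_nonneg hx hx) hx,
          ← ENNReal.ofReal_pow hL.le, ← ENNReal.ofReal_mul hL3.le]
        congr 1
        ring

/-! ### The registered stub -/

/-- **Registered stub `stub_lineMoments`** of the line `parseval-shell-bootstrap` (r4): the bath
moment of the flattening flow is paid by `ConditionalDensityMoments` at the orders `12` and `6`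
(statement `Goal.stub_lineMoments = LineFubini → ConditionalDensityMoments → LineMomentBound`).
[folklore] -/
theorem stub_lineMoments : Goal.stub_lineMoments :=
  fun hlf hcdm => lineMomentBound_of hlf hcdm

end Summit.AtomisticToContinuum.BoseEinsteinCondensation.Cruxes.FibreConductance.ParsevalShellBootstrap

end
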